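import Summits.BirchSwinnertonDyer.BirchSwinnertonDyer.Theorems.ByReductionTypeAtTwoOrdKatoHalfAtTwoIsoStepFourOfXInf
import HarnessLib

/-!
# Route ByReductionTypeAtTwo, crux `OrdKatoHalfAtTwoIso` (stmt-BirchSwinnertonDyer-19573), line `steinberg-fibre-at-two`
# (skeleton v11), stub `stub_coreA_posDisc : CoreTheoremAPosDiscTwo` — plan item (P2)(d): a class whose cocycle VANISHES AT
# EVERY COMPLEX CONJUGATION is locally trivial at the real place (and so are its shifts `T^[k]`) — the bridge from
# `Φ(c) = 0` (`…KolyvaginRealComponent`, `…KolyvaginCocycleRealValue`) to the hypothesis `hxinf` of Step 4 (`…StepFourOfXInf`)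

Seat `cruxlead-stmt-BirchSwinnertonDyer-19573-g5` (LEAD PROVER, MODE LINE; HOME `run/shared/lean/pub/bsd-2adic/`; `--supports`
stmt-BirchSwinnertonDyer-19573 as helper). THEOREMS ONLY; nothing asserted; BSD is not proved by any of this; the crux and the stub
are NOT proved here.

Contents (sorry-free): `localization_inl_oneCocycleClass_eq_zero_of_forall_isComplexConjugationAt` — for a discrete `Γ_ℚ`-module
`M` and a continuous cocycle `c` with `c σ = 0` for every complex conjugation `σ` at the real place `w`, the localisation of `[c]`
at `Sum.inl w` vanishes (`Γ_{ℚ_w}` has the two elements `1` and a complex conjugation, `isComplexConjugationAt_absGaloisRestrict_of_ne_one`,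
so the pulled-back cocycle is identically `0`); `localization_inl_iterate_shiftH1_eq_zero_of_forall` — the same for every shift
`T^[k] [Φ]` of a class of the Iwasawa twist `𝒯_J(E) = W.modPTwist 2 κ J` (`(S^k Φ)(σ) = S^k (Φ σ)`), i.e. exactly the hypothesis
`hxinf` of `StepFour.convCoeff_eq_zero_of_qTermIdentity_modPTwist_two_of_xinf` (p685843) for a Kolyvagin cocycle `Φ` with
`Φ(c) = 0` at every complex conjugation (`exists_kolyvaginCocycle_value_noTransverse_realZero` at `ℓ ≡ 1 (mod 4)`, `0 < Δ`).

References: J.-P. Serre, *Galois Cohomology* (1997) I §2.4, II §6.1 [SerreGaloisCohomology1997]; J. S. Milne, *Arithmetic Duality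
Theorems* (2006) I §4 [MilneADT2006]; tree `…PortRealPlace.lean` §3 (the `Δ < 0` twin: the whole local `H¹` vanishes),
`AbsGaloisRestrictRealPlace.lean`, `KummerSelmerStructure.lean` (`galoisCohomology.res_one_oneCocycleClass`),
`IwasawaTwistModPTower.lean` (`shiftH1_iterate_oneCocycleClass`).
-/

set_option autoImplicit false
-- the summit and its single problem are both named `BirchSwinnertonDyer` (registry layout D-0017)
set_option linter.dupNamespace false

noncomputable section

open NumberField Field
open Literature.NumberTheory.GaloisRepresentations
open Literature.NumberTheory.GaloisCohomology
open Literature.NumberTheory.EllipticCurves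
open _root_.TopRep _root_.ContRepresentation _root_.ContinuousCohomology

namespace Summit.BirchSwinnertonDyer.BirchSwinnertonDyer.Rank1Residual

/-! ### §1 Generic: cocycles vanishing at every complex conjugation are locally trivial at the real place -/

/-- **A class whose cocycle vanishes at every complex conjugation at `w` is locally trivial at the real place `w`.** For a
discrete `Γ_ℚ`-module `M`, a continuous cocycle `c`, and an infinite place `w` of `ℚ`: if `c σ = 0` for every complex
conjugation `σ` at `w`, then `loc_{Sum.inl w} [c] = 0`. Proof: the localisation is the class of the cocycle `τ ↦ c (res τ)` on
`Γ_{ℚ_w}` (`galoisCohomology.res_one_oneCocycleClass`); `Γ_{ℚ_w}` consists of `1` (where every cocycle vanishes) and elements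
`τ ≠ 1` whose restrictions to `Γ_ℚ` are complex conjugations at `w` (`isComplexConjugationAt_absGaloisRestrict_of_ne_one`), so
that cocycle is `0`. [cite: SerreGaloisCohomology1997, II §6.1] [cite: MilneADT2006, Ch. I §4 (p. 55)] -/
theorem localization_inl_oneCocycleClass_eq_zero_of_forall_isComplexConjugationAt
    {M : Type} [AddCommGroup M] [TopologicalSpace M] [DiscreteTopology M] (ρ : DiscreteGaloisModule ℚ M)
    (c : contOneCocycles ρ.toTopRep) (w : InfinitePlace ℚ)
    (h : ∀ σ : absoluteGaloisGroup ℚ, IsComplexConjugationAt (IsTotallyReal.isReal w) σ → c.1 σ = 0) :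
    galoisCohomology.localization ρ (Sum.inl w) 1 (oneCocycleClass ρ.toTopRep c) = 0 := by
  have hw : w.IsReal := IsTotallyReal.isReal w
  change galoisCohomology.res ρ (Place.Completion (Sum.inl w)) 1 (oneCocycleClass ρ.toTopRep c) = 0
  rw [galoisCohomology.res_one_oneCocycleClass]
  have hzero : contOneCocycles.pullback (absGaloisRestrict ℚ (Place.Completion (Sum.inl w))) (X := ρ.toTopRep)
      (Y := DiscreteGaloisModule.toTopRep (GaloisRep.restrictField (Place.Completion (Sum.inl w)) ρ))
      (TopRep.ofHom ⟨ContinuousLinearMap.id ℤ M, fun _ => rfl⟩) c = 0 := by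
    apply Subtype.ext
    ext τ
    rw [contOneCocycles.pullback_apply]
    change c.1 (absGaloisRestrict ℚ (Place.Completion (Sum.inl w)) τ) = 0
    by_cases hτ : τ = 1
    · rw [hτ, map_one, contOneCocycles.apply_one]
    · exact h _ (isComplexConjugationAt_absGaloisRestrict_of_ne_one hw hτ)
  rw [hzero, oneCocycleClass_zero]
  rfl

/-! ### §2 The Iwasawa twists at `p = 2`: the hypothesis `hxinf` of Step 4 from `Φ(c) = 0` -/

/-- **`hxinf` from the vanishing of the Kolyvagin cocycle at complex conjugations.** For `𝒯_J(E) = W.modPTwist 2 κ J` and a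
continuous cocycle `Φ` with `Φ σ = 0` for every complex conjugation `σ` at the real place `w`, EVERY shift `T^[k] [Φ]` is locally
trivial at `Sum.inl w` (`T^[k] [Φ] = [S^k ∘ Φ]`, `shiftH1_iterate_oneCocycleClass`, and `(S^k ∘ Φ)(σ) = S^k (Φ σ) = 0`). With
`exists_kolyvaginCocycle_value_noTransverse_realZero` (Kolyvagin primes `ℓ ≡ 1 (mod 4)`; complex conjugation trivial on `E[2]` at
`0 < Δ`, p686322) this is the hypothesis `hxinf` of `StepFour.convCoeff_eq_zero_of_qTermIdentity_modPTwist_two_of_xinf` (p685843).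
[cite: SerreGaloisCohomology1997, II §6.1] [cite: Washington1997, §13.1–§13.2] -/
theorem localization_inl_iterate_shiftH1_eq_zero_of_forall (W : WeierstrassCurve ℚ) (κ : ZpExtension ℚ 2) (J : ℕ)
    (Φ : contOneCocycles (W.modPTwist 2 κ J).toTopRep) (w : InfinitePlace ℚ)
    (h : ∀ σ : absoluteGaloisGroup ℚ, IsComplexConjugationAt (IsTotallyReal.isReal w) σ → Φ.1 σ = 0) (k : ℕ) :
    galoisCohomology.localization (W.modPTwist 2 κ J) (Sum.inl w) 1
      ((κ.shiftH1 (W.torsionGaloisModule ((2 : ℕ) : ℤ))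
        (fun P : WeierstrassCurve.geomTorsion W ((2 : ℕ) : ℤ) => AddSubgroup.torsionBy.nsmul P) J)^[k]
        (oneCocycleClass (W.modPTwist 2 κ J).toTopRep Φ)) = 0 := by
  unfold WeierstrassCurve.modPTwist at Φ h ⊢
  rw [ZpExtension.shiftH1_iterate_oneCocycleClass]
  refine localization_inl_oneCocycleClass_eq_zero_of_forall_isComplexConjugationAt _ _ w fun σ hσ => ?_
  rw [ZpExtension.shiftPowCocycle_apply, h σ hσ, map_zero]

end Summit.BirchSwinnertonDyer.BirchSwinnertonDyer.Rank1Residual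

end
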